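import Mathlib
import Summits.NavierStokesRegularity.NavierStokesRegularity.Theorems.TaoLadderRungTwoFlatBehindBlockExport
import Summits.NavierStokesRegularity.NavierStokesRegularity.Theorems.TaoLadderRungTwoFlatEnvelopeAhead
import Summits.NavierStokesRegularity.NavierStokesRegularity.Theorems.TaoLadderRungTwoFlatEnvelopeBehind
import Summits.NavierStokesRegularity.NavierStokesRegularity.Theorems.TaoLadderRungTwoFlatTubeStepLandSplit
import HarnessLib

/-!
# THE ENVELOPE OBLIGATION `TubeStepEnvelopeWith` AT THE CHOICE RULE, ASSEMBLED (generic slot; hop `n > N₀`)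
  (helper for the K_A♭ parent item stmt-NavierStokesRegularity-22987 `FlatGapCertificatesV2`, route TaoLadderRungTwoFlat; cell
  harvest/h2-tao-ladder, p1 g24; LADDER §50.8–50.9 (`tubeEnv`), §54, §61–§62)

Along every premise flow and up to the chosen (good) section time, every shell energy is below `env₀ k`: behind the window (`k ≤ −K`)
from the in-hop block energies (`behindBlockEnergies_of_schedule_slot` + `envelopeBehind_of_blockEnergies`), at the interface shell
(`k = 1−K`) from the template bound and the interface level (`interfaceLevels_of_schedule_slot`), on the window `2−K ≤ k ≤ k_H+1` from the
in-hop hull (E2 readout, hypothesis `hhull`), and ahead (`k > k_H+1`) from the cut schedule (`aheadCuts_of_schedule` + `envelopeAhead_of_cuts`,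
initial tails discharged by `initialTails_of_premise_slot`); energies are `≤ ½S²` by `energy_le_half_sq_of_premiseFlow`.

* `tubeStepEnvelopeWith_of_schedule_slot`.

HONEST FRAMING: composition over the cell's typed induction frame (MODEL lattice, graded mirror table on `S♭`); the window hull, the cut
schedule and the four envelope rows are HYPOTHESES; nothing certified; no item closed; nothing about the Navier–Stokes equations.
-/

noncomputable section

-- the sub-problem namespace repeats the summit name by design (D-0017)
set_option linter.dupNamespace false

namespace Summit.NavierStokesRegularity.NavierStokesRegularity.Theorems.HopTube

open Set Finset Literature.Analysis.FluidPDE Literature.Analysis.FluidPDE.TaoCascade MirrorPulse GappedFrontRobustOn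

section Envelope

variable {ε ε₀ : ℝ}

set_option maxHeartbeats 400000 in
/-- **`TubeStepEnvelopeWith` AT THE CHOICE RULE, ASSEMBLED** (generic slot `Bcl → behindR54`, hop `n > N₀`). See the module docstring.
[cite: Tao2016AveragedNS, §6.2 Prop. 6.3 (ix), §6.4 Prop. 6.5 (iv) (statement shape); cell LADDER §50.8–50.9 (`tubeEnv`), §54, §61–§62] -/
theorem tubeStepEnvelopeWith_of_schedule_slot (P : TubeSchedule) {θ' : ℝ} {Wb : ℕ → ℝ} {i₀ : Fin 2}
    {Bcl : ℕ → (Fin 2 → ℤ → ℝ) → Prop} (hBcl : ∀ m z, Bcl m z → behindR54 P θ' Wb m z)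
    {X₀ : Fin 2 → ℝ} {w : ℤ → ℝ} {r θ₀ c₀ t₀ : ℝ} {ζ : ℕ → Fin 2 → ℤ → ℝ} {ustar : Fin 2 → ℤ → ℝ}
    {good : ℕ → (Fin 2 → ℤ → ℝ → ℝ) → ℝ → Prop} {n : ℕ}
    {cW κ₂ : ℝ} {W₀ FW₀ BW₀ : (Fin 2 → ℤ → ℝ) → Fin 2 → ℤ → ℝ} {W FW : (Fin 2 → ℤ → ℝ) → Fin 2 → ℤ → ℝ → ℝ}
    (hWflow : ∀ z, InTubeWith P Bcl i₀ X₀ w r ζ ustar n z →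
      PseudoFlowOnShift shiftSetFlat cW ε₀ (mirrorTable ε ε) 0 κ₂ (W₀ z) (FW₀ z) (BW₀ z) (W z) (FW z)) (hcW : c₀ ≤ cW)
    (hε : 0 ≤ ε) (hε₀ : 0 < ε₀) (hn : P.N₀ < n) (hK : 1 ≤ P.K) (hDK : P.K + 1 ≤ P.D) (hθV : 0 < P.θV)
    (hθ : 0 < θ') (hθ5 : θ' ≤ 5 * Real.log (1 + ε₀)) (hw1 : ∀ k, 1 ≤ w k) (hr0 : 0 ≤ r)
    (hAstar : 0 < P.Astar) {ωK MuK : ℝ} (hωK : 0 < ωK)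
    (hωKle : ∀ i, ωK ≤ MirrorPulse.geomGauge P.g P.b i (-(P.K : ℤ))) (hMuK : ∀ i, |ustar i (-(P.K : ℤ))| ≤ MuK)
    (hWbn : 0 ≤ Wb n)
    {tlo : ℝ} (htlo : 0 < tlo)
    (hwin : ∀ z S₀ τ S F, HopPremiseWith P Bcl shiftSetFlat ε₀ i₀ (mirrorTable ε ε) X₀ w r c₀ ζ
      ustar n z S₀ τ S F → ∀ t, good n S t → tlo ≤ t ∧ t ≤ c₀)
    {Aeff A A₀ A₁ M M₁ M₂ rI RBAR BBAR RHO2 rs I₁ I₂ PUMP μN μB VbarN VbarB EW V₀N V₀B EN : ℝ}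
    (hAeff : 0 < Aeff) (hM0 : 0 ≤ M)
    (hM : ∀ z, InTubeWith P Bcl i₀ X₀ w r ζ ustar n z →
      ∀ s ∈ Icc 0 c₀, ∀ i, ∀ m ∈ Finset.Icc (-(P.D : ℤ)) (1 - (P.K : ℤ)), |W z i m s| ≤ M)
    (hM₁ : ∀ z, InTubeWith P Bcl i₀ X₀ w r ζ ustar n z → ∀ s ∈ Icc 0 c₀, |W z 1 (-(P.K : ℤ)) s| ≤ M₁)
    (hM₂0 : 0 ≤ M₂)
    (hM₂ : ∀ z, InTubeWith P Bcl i₀ X₀ w r ζ ustar n z → ∀ s ∈ Icc 0 c₀, |W z 0 (2 - (P.K : ℤ)) s| ≤ M₂)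
    (hEW : ∀ z, InTubeWith P Bcl i₀ X₀ w r ζ ustar n z →
      coMovingEnergyOn (Finset.Icc (1 - (P.D : ℤ)) (-(P.K : ℤ))) P.θV (-(P.K : ℝ))
        (fun i k _ => anchorScale P i₀ z * ustar i k - W₀ z i k) 0 ≤ EW)
    -- section datum at the interface shell and the deeper core input (the only in-hop core data)
    (hsec : ∀ z S₀ τ S F, HopPremiseWith P Bcl shiftSetFlat ε₀ i₀ (mirrorTable ε ε) X₀ w r c₀ ζ
      ustar n z S₀ τ S F → ∀ i, |(S - W z) i (1 - (P.K : ℤ)) 0| ≤ rs)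
    (hρ0 : 0 ≤ RHO2)
    (hcore2 : ∀ z S₀ τ S F, HopPremiseWith P Bcl shiftSetFlat ε₀ i₀ (mirrorTable ε ε) X₀ w r c₀ ζ
      ustar n z S₀ τ S F → ∀ t, good n S t → ∀ s ∈ Icc 0 t, |(S - W z) 0 (2 - (P.K : ℤ)) s| ≤ RHO2)
    -- interface levels (L-61a/L-61b) and link facts
    (hRB0 : 0 ≤ RBAR) (hBB0 : 0 ≤ BBAR) (hRr : RBAR ≤ rI) (hBr : BBAR ≤ rI) (hVN0 : 0 ≤ VbarN)
    (hI₁0 : 0 ≤ I₁) (hI₂0 : 0 ≤ I₂)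
    (hI₁ : 2 * (Real.exp (P.θV / 2) - 1) ≤ I₁ * P.θV) (hI₂ : Real.exp P.θV - 1 ≤ I₂ * P.θV)
    (hPUMPdef : PUMP = 1 * c₀ * ((2 + ε) * M * I₁ * Real.sqrt (2 * VbarN) + 2 * I₂ * VbarN))
    (hlevC : rs + PUMP + 1 * c₀ * ((ε * (M + I₁ * Real.sqrt (2 * VbarN)) + ε * M + ε * BBAR) * RBAR
      + (2 + ε) * M * BBAR + BBAR ^ 2) < RBAR)
    (hlevV : rs + 1 * c₀ * ((M + M₂ + RBAR + RHO2) * BBAR + (1 + 2 * ε) * M * RBAR + ε * RBAR ^ 2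
      + (M + 2 * ε * M₂) * RHO2 + ε * RHO2 ^ 2) < BBAR)
    -- near/behind schedule (window forms)
    (hAdef : A = Real.sqrt (2 * VbarB) * Real.exp (θ' / 2) * Real.exp (θ' * ((P.D : ℝ) - P.K) / 2) + M)
    (hA₀def : A₀ = M + rI) (hA₁def : A₁ = M₁ + Real.sqrt (2 * VbarN) * Real.exp (P.θV / 2))
    (hrA : rI ≤ A) (hA₀le : A₀ ≤ Aeff)
    (hV₀Ndef : V₀N = (Real.sqrt (P.v n + (P.δ n / ωK) ^ 2) + Real.sqrt P.D * r + Real.sqrt EW) ^ 2)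
    (hV₀Bdef : V₀B = (Real.sqrt (Wb n + (MuK + P.δ n / ωK) ^ 2) + r / Real.sqrt (1 - Real.exp (-θ'))) ^ 2)
    (hENdef : EN = Real.exp (P.θV * ((1 : ℝ) - P.D + P.K)) * ((1 + ε) * 1 * A ^ 2 * (A + M))
      + 1 * rI * (2 * VbarN + ε * rI * Real.sqrt (2 * VbarN) + (1 + ε) * M * rI))
    (hμN : 0 < μN)
    (hμNle : μN ≤ (1 / c₀) * P.θV - 2 * (1 + ε) * 1 * (A * Real.sinh (P.θV / 2) + M * (3 + Real.exp P.θV)))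
    (hμB : 0 < μB) (hμBle : μB ≤ (1 / c₀) * θ' - 2 * (1 + ε) * Aeff * Real.sinh (θ' / 2))
    (hlevN : V₀N + EN * c₀ < VbarN) (hlevB : V₀B + A₁ * A₀ * (A₁ + ε * A₀) * c₀ < VbarB)
    (hclose : Real.sqrt (2 * VbarB) * Real.exp (θ' / 2) ≤ Aeff)
    -- the envelope inputs: a good time exists; the in-hop window hull (E2); the cut schedule; the rows against `env₀`
    {env₀ Hk : ℤ → ℝ} {kH : ℤ} {Vtop : ℝ} {G Ω : ℤ → ℝ} (hc₀ : 0 ≤ c₀)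
    (hex : ∀ z S₀ τ S F, HopPremiseWith P Bcl shiftSetFlat ε₀ i₀ (mirrorTable ε ε) X₀ w r c₀ ζ ustar n z S₀ τ S F →
      ∃ t, good n S t)
    (hhull : ∀ z S₀ τ S F, HopPremiseWith P Bcl shiftSetFlat ε₀ i₀ (mirrorTable ε ε) X₀ w r c₀ ζ ustar n z S₀ τ S F →
      ∀ t, good n S t → ∀ s ∈ Icc 0 t, ∀ (i : Fin 2) (k : ℤ), 2 - (P.K : ℤ) ≤ k → k ≤ kH + 1 → |S i k s| ≤ Hk k)
    (hk₁ : (P.k₁ : ℤ) ≤ kH + 2) (hVtop : 0 ≤ Vtop) (hG0 : ∀ j, kH < j → 0 ≤ G j)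
    (hVt : ∀ z S₀ τ S F, HopPremiseWith P Bcl shiftSetFlat ε₀ i₀ (mirrorTable ε ε) X₀ w r c₀ ζ ustar n z S₀ τ S F →
      ∀ t ∈ Icc 0 c₀, |S 1 (kH + 1) t| ≤ Vtop)
    (hΩ : ∀ j, kH < j → ∀ N : Finset ℤ, (∀ m ∈ N, j < m) → ∑ m ∈ N, (w m)⁻¹ ^ 2 ≤ Ω j)
    (hGΩ : ∀ j, kH < j → 2 * (9 / 8 * r) ^ 2 * Ω j ≤ G j ^ 2)
    (hclose0 : 4 / 3 * c₀ * clock ε₀ (kH + 1) * Vtop * (Vtop + 2 * ε * G (kH + 1)) < G (kH + 1))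
    (hcloseG : ∀ j, kH + 1 ≤ j →
      4 / 3 * c₀ * clock ε₀ (j + 1) * (2 * G j) * (2 * G j + 2 * ε * G (j + 1)) < G (j + 1))
    (henvB : ∀ k : ℤ, k ≤ -(P.K : ℤ) →
      Real.exp (θ' * ((1 : ℝ) - P.K - k)) * (V₀B + A₁ * A₀ * (A₁ + ε * A₀) * c₀) ≤ env₀ k)
    (henvI : (1 / 2) * (M + rI) ^ 2 ≤ env₀ (1 - (P.K : ℤ)))
    (henvW : ∀ k : ℤ, 2 - (P.K : ℤ) ≤ k → k ≤ kH + 1 → (1 / 2) * Hk k ^ 2 ≤ env₀ k)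
    (henvA : ∀ m : ℤ, kH + 1 < m → 2 * G (m - 1) ^ 2 ≤ env₀ m) :
    TubeStepEnvelopeWith P Bcl (choiceRule P i₀ ε₀ θ₀ t₀ good) shiftSetFlat ε₀ i₀ (mirrorTable ε ε) X₀ w r c₀ env₀ ζ
      ustar n := by
  have hwin' : ∀ z S₀ τ S F, HopPremiseWith P Bcl shiftSetFlat ε₀ i₀ (mirrorTable ε ε) X₀ w r c₀ ζ
      ustar n z S₀ τ S F → ∀ t, good n S t → 0 < t ∧ t ≤ c₀ := fun z S₀ τ S F h t ht =>
    ⟨htlo.trans_le (hwin z S₀ τ S F h t ht).1, (hwin z S₀ τ S F h t ht).2⟩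
  -- the three in-hop producers: behind block energies, interface levels, ahead cuts
  have hblocks := behindBlockEnergies_of_schedule_slot P hBcl hWflow hcW hε hε₀ hn hK hDK hθV hθ hθ5 hw1 hr0 hAstar hωK hωKle hMuK hWbn htlo hwin hAeff hM0 hM hM₁ hM₂0 hM₂ hEW hsec hρ0 hcore2 hRB0 hBB0 hRr hBr hVN0 hI₁0 hI₂0 hI₁ hI₂ hPUMPdef hlevC hlevV hAdef hA₀def hA₁def hrA hA₀le hV₀Ndef hV₀Bdef hENdef hμN hμNle hμB hμBle hlevN hlevB hclose
  have hlevI := interfaceLevels_of_schedule_slot P hBcl hWflow hcW hε hε₀ hn hK hDK hθV hθ hθ5 hw1 hr0 hAstar hωK hωKle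
    hMuK hWbn hwin' hAeff hM0 hM hM₁ hM₂0 hM₂ hEW hsec hρ0 hcore2 hRB0 hBB0 hRr hBr hVN0 hI₁0 hI₂0 hI₁ hI₂ hPUMPdef
    hlevC hlevV hAdef hA₀def hA₁def hrA hA₀le hV₀Ndef hV₀Bdef hENdef hμN hμNle hμB hμBle hlevN hlevB hclose
  have hw0 : ∀ k, 0 < w k := fun k => lt_of_lt_of_le one_pos (hw1 k)
  have hinit := initialTails_of_premise_slot (ε := ε) (ε₀ := ε₀) (Bcl := Bcl) (i₀ := i₀) (X₀ := X₀) (c₀ := c₀)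
    (ζ := ζ) (ustar := ustar) P hn hw0 hr0 hk₁ hΩ hGΩ
  have hcuts := aheadCuts_of_schedule (P := P) (Bcl := Bcl) (i₀ := i₀) (X₀ := X₀) (w := w) (r := r) (ζ := ζ) (ustar := ustar)
    (n := n) hε hε₀ hc₀ hVtop hG0 hVt hinit hclose0 hcloseG
  have hahead := envelopeAhead_of_cuts (env₀ := env₀) hcuts henvA
  -- assemble along every premise up to the chosen (good) section time
  intro z S₀ τ S F hprem s hs
  have hgood := chooseTime_spec (t₀ := t₀) (hex z S₀ τ S F hprem)
  simp only [choiceRule_τ₁] at hs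
  set t := chooseTime good t₀ n S with htdef
  obtain ⟨htpos, htc₀⟩ := hwin' z S₀ τ S F hprem t hgood
  have hsc : s ∈ Icc 0 c₀ := ⟨hs.1, hs.2.trans htc₀⟩
  have hrI0 : 0 ≤ rI := hRB0.trans hRr
  have hA₁0 : 0 ≤ A₁ := by
    rw [hA₁def]
    obtain ⟨hzI, -, -, -⟩ := hprem
    have hM₁0 : 0 ≤ M₁ := (abs_nonneg _).trans (hM₁ z hzI 0 ⟨le_rfl, htpos.le.trans htc₀⟩)
    exact add_nonneg hM₁0 (mul_nonneg (Real.sqrt_nonneg _) (Real.exp_pos _).le)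
  have hA₀0 : 0 ≤ A₀ := by rw [hA₀def]; exact add_nonneg hM0 hrI0
  have hEtop0 : 0 ≤ A₁ * A₀ * (A₁ + ε * A₀) :=
    mul_nonneg (mul_nonneg hA₁0 hA₀0) (add_nonneg hA₁0 (mul_nonneg hε hA₀0))
  -- energies are `≤ ½S²` (zero-slack exact premise flow)
  have hF : ∀ (i : Fin 2) (k : ℤ), F i k s ≤ (1 / 2) * S i k s ^ 2 := by
    obtain ⟨-, -, hc₀τ, hflow⟩ := hprem
    exact fun i k => energy_le_half_sq_of_premiseFlow hflow ⟨hs.1, hsc.2.trans hc₀τ⟩ i k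
  intro i k
  rcases le_or_gt k (-(P.K : ℤ)) with hkB | hkB
  · -- behind the window: block energies
    have hσs : 1 / t * s ≤ 1 := by rw [one_div, inv_mul_le_iff₀ htpos]; linarith [hs.2]
    have hV0 : 0 ≤ V₀B + A₁ * A₀ * (A₁ + ε * A₀) * c₀ := by
      have h0 : 0 ≤ V₀B := by rw [hV₀Bdef]; positivity
      positivity
    refine envelopeBehind_of_blockEnergies hθ.le hV0 hσs hF (fun L => ?_) henvB i k hkB
    have hb := hblocks z S₀ τ S F hprem t hgood s hs L
    have hmono : A₁ * A₀ * (A₁ + ε * A₀) * s ≤ A₁ * A₀ * (A₁ + ε * A₀) * c₀ :=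
      mul_le_mul_of_nonneg_left hsc.2 hEtop0
    linarith
  · rcases le_or_gt k (1 - (P.K : ℤ)) with hkI | hkI
    · -- the interface shell `k = 1 − K`: template + interface level
      have hk1 : k = 1 - (P.K : ℤ) := by omega
      subst hk1
      obtain ⟨h0, h1⟩ := hlevI z S₀ τ S F hprem t hgood s hs
      obtain ⟨hzI, -, -, -⟩ := hprem
      have hWle : |W z i (1 - (P.K : ℤ)) s| ≤ M :=
        hM z hzI s hsc i _ (by simp only [Finset.mem_Icc]; omega)
      have hdev : |(S - W z) i (1 - (P.K : ℤ)) s| ≤ rI := by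
        fin_cases i
        · exact h0.trans hRr
        · exact h1.trans hBr
      have hS : |S i (1 - (P.K : ℤ)) s| ≤ M + rI := by
        have e : S i (1 - (P.K : ℤ)) s = W z i (1 - (P.K : ℤ)) s + (S - W z) i (1 - (P.K : ℤ)) s := by
          simp only [Pi.sub_apply]; ring
        rw [e]; exact (abs_add_le _ _).trans (add_le_add hWle hdev)
      have hsq : S i (1 - (P.K : ℤ)) s ^ 2 ≤ (M + rI) ^ 2 := by
        rw [← sq_abs]; exact pow_le_pow_left₀ (abs_nonneg _) hS 2
      calc F i (1 - (P.K : ℤ)) s ≤ (1 / 2) * S i (1 - (P.K : ℤ)) s ^ 2 := hF i _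
        _ ≤ (1 / 2) * (M + rI) ^ 2 := by linarith
        _ ≤ env₀ (1 - (P.K : ℤ)) := henvI
    · rcases le_or_gt k (kH + 1) with hkW | hkW
      · -- the window (E2 hull)
        have hS := hhull z S₀ τ S F hprem t hgood s hs i k (by omega) hkW
        have hsq : S i k s ^ 2 ≤ Hk k ^ 2 := by
          rw [← sq_abs]; exact pow_le_pow_left₀ (abs_nonneg _) hS 2
        calc F i k s ≤ (1 / 2) * S i k s ^ 2 := hF i k
          _ ≤ (1 / 2) * Hk k ^ 2 := by linarith
          _ ≤ env₀ k := henvW k (by omega) hkW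
      · -- ahead: the cuts
        exact hahead z S₀ τ S F hprem s hsc i k hkW

end Envelope

end Summit.NavierStokesRegularity.NavierStokesRegularity.Theorems.HopTube

end
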